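import Literature.Geometry.DiscreteGeometry.HexagonalSpiral
import HarnessLib

/-!
# Strachan–Swanepoel 2026: edge isoperimetry of Cayley graphs on `ℤ^d` — no nested solutions for
# `{±eᵢ} ∪ {±2e₁}`, and the solved EIP of the triangular lattice with first AND second neighbours

Topic `Literature/Combinatorics/Extremal`; cross-ladder literature-typing layer (D-0088 (4)), cell
`crystal3d-full`, seat `littype-FC1-2` (gen 7), recent-theorem harvest along row (4)'s topic (edge-
isoperimetric problems on lattices = finite crystallization for sticky-type energies: the tree's
`TriangularLatticeEdgeIsoperimetry.lean` (Davoli–Piovano–Stefanelli 2017, first neighbours only),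
`SquareLatticeEdgeIsoperimetry.lean` / `CubicLatticeEdgeIsoperimetry.lean` (`ℤ²`, `ℤ³`), and the
finite-range `Γ`-limit of `FiniteRangeLatticeGammaLimit.lean` (Del Nin–Petrache 2022), of which the
second theorem below is an EXACT finite-`n` instance: range-two bonds on the triangular lattice).

## Source, as printed

C. Strachan, K. Swanepoel, *Edge Isoperimetry of Lattices*, Annals of Combinatorics (2026),
doi:10.1007/s00026-025-00801-x = arXiv:2503.09591 [StrachanSwanepoel2026] — read on the held arXiv
text `paper:arxiv-2503.09591` (`pNNNN` = chunk of the held text; §-numbers as printed).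

* §1, Definition 1 (p0003): "Given a graph `G`, the edge boundary of `S ⊆ V(G)` is
  `∂(S) := |{uv ∈ E(G) : u ∈ S, v ∉ S}|`.  The edge isoperimetric problem (EIP) of a graph `G` is, for
  a given `n`, to minimize `∂(S)` over all `S ⊆ V(G)` where `|S| = n`.  We call such minimizing sets
  solutions to the EIP of `G`. … A nested solution for the EIP of `G` is an ordering `v₁, v₂, …` of the
  vertex set `V(G)` such that for each `n`, the set `{v₁, v₂, …, v_n}` is a solution to the EIP of `G`."
* §1, Definition 2 (p0003): "Let `U` be a finite set that generates `ℤ^d` as a group and does not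
  contain the identity.  The (directed) Cayley graph `ℤ^d_U` is the graph on the vertex set `ℤ^d` where
  `(u,v)` is an edge whenever `v − u ∈ U`.  When `U` is symmetric … we consider `ℤ^d_U` to be
  undirected."  P0003: "If `G` is an undirected `k`-regular graph, for any `S ⊆ V(G)` we have
  `|E(G[S])| = (k|S| − ∂(S))/2`.  … for regular graphs the problem of minimizing `∂(S)` over all
  subsets with size `n` is the same as maximizing `|E(G[S])|`."
* **Theorem 1** (p0003). "The EIP for `ℤ^d_U`, where `U` is the generating set
  `{±eᵢ : i = 1,…,d} ∪ {±2e₁}` of `ℤ^d`, does not have nested solutions starting at any size.  In other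
  words, for all `n` and each `n`-element subset `S_n` of `ℤ^d` for which `∂(S_n)` is the minimum among
  all `n`-element subsets of `ℤ^d_U`, there does not exist a sequence `S_n ⊂ S_{n+1} ⊂ S_{n+2} ⊂ ⋯` of
  `i`-element subsets `Sᵢ` of `ℤ^d`, such that for each `i ≥ n`, `∂(Sᵢ)` is the minimum among all
  `i`-element subsets of `ℤ^d_U`."  (Abstract and §1: "for all `d ≥ 2`"; the proof (§2, p0005) uses
  Bollobás–Leader and the Loomis–Whitney inequality.)
* P0003–p0004: "`Λ := {m g₁ + n g₂ : m, n ∈ ℤ}`, `g₁ = (1,0)`, `g₂ = (½, √3/2)`"; the second graph "is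
  the graph on the triangular lattice with edges for all pairs at distance `1` or `√3`", its generating
  set "`U = {±g₁, ±(g₁+g₂), ±g₂, ±(2g₂−g₁), ±(g₂−g₁), ±(g₂−2g₁)}`", denoted `Λ_U` (12-regular, p0006:
  "`|E(Λ_U[S])| = 6n − ∂(S)/2`").
* **Theorem 2** (p0004). "Let `Λ_U` be the undirected Cayley graph with vertex set `Λ` and symmetric
  generating set `U` [as above].  The maximum number of edges of a subgraph of `Λ_U` (necessarily
  induced) with `n ≥ 3` vertices is `e(n) := 6n − 4√(6n−6)` if `n = 24k² − 24k + 7` for some `k ∈ ℕ`,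
  `⌊6n − √(96n − 63)⌋` otherwise.  Additionally, the EIP of `Λ_U` has nested solutions."  P0004:
  "The first few values of `n` where `e(n) = 6n − 4√(6n−6)` are `n = 7, 55, 151, 295, 487` and `727`."
  (Proof §3–§5 with computer-checked base cases `n ≤ 30` and symbolic computations, p0006.)
* Conjecture 3 (p0004, Erdős–Vesztergombi problem): `f(n) = e(n)` for large `n`, `f(n)` the maximum
  of `m₁(S) + m₂(S)` (occurrences of the smallest and second smallest distance) over `n`-point planar
  sets — an OPEN PROBLEM, recorded here only as context (not typed: conjectures are not Literature).

## Rendering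

* Cayley graphs on an additive group `G` with a finite symmetric generating set `U`: the edge boundary
  of Definition 1 is `edgeBoundary U S = #{(x, u) ∈ S × U : x + u ∉ S}` (for symmetric `U` each
  boundary edge `{x, x+u}`, `x ∈ S`, `x + u ∉ S`, is counted exactly once); the number of edges of the
  induced subgraph is recorded DOUBLED as the number of ordered adjacent pairs
  `inducedDarts U S = #{(x, y) ∈ S × S : y − x ∈ U}` (`= 2|E(G_U[S])|` for symmetric `U`, as in the
  tree's `Harborth.darts`).  "Solution to the EIP" = `IsEIPSolution` (minimal `∂` at its cardinality);
  "nested solutions" = an enumeration `v : ℕ → G` (a bijection) all of whose initial segments are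
  solutions (`HasNestedSolutions`).
* `ℤ^d = Fin d → ℤ` (the tree's `Site d`); `eᵢ = Pi.single i 1`; `e₁` is the coordinate of index `0`
  (`d ≥ 2`).
* `Λ` is rendered by LABELS `(m, n) ∈ ℤ × ℤ ↔ m g₁ + n g₂` (the tree's `Theil2006.triPoint`, norm form
  `HarborthSpiral.normForm (m,n) = m² + mn + n² = |m g₁ + n g₂|²`): the twelve generators are the labels
  of norm form `1` (distance `1`) or `3` (distance `√3`) — `triTwoDistanceGenerators`, with
  `mem_triTwoDistanceGenerators_iff` PROVED.
* `e(n)` is an integer-valued function of `n` (`maxEdges`); in the exceptional case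
  `6n − 6 = (12k − 6)²` so `6n − 4√(6n−6) = 6n − 48k + 24 ∈ ℤ` (`maxEdges_seven : e(7) = 18` PROVED:
  the hexagon `H₁` with its `12` unit and `6` `√3`-bonds).

## Contents (namespace `Literature.Combinatorics.Extremal.StrachanSwanepoel2026`)

`edgeBoundary`, `inducedDarts`, `IsEIPSolution`, `HasNestedSolutions` (general Cayley-graph EIP
vocabulary); `doubledAxisGenerators d i₀` (`{±eᵢ} ∪ {±2e_{i₀}}`), NAMED FACT
`StrachanSwanepoel2026_noNestedSolutions` (Theorem 1); `triTwoDistanceGenerators`, `maxEdges`,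
NAMED FACTS `StrachanSwanepoel2026_maxEdges` (Theorem 2, the value `e(n)`) and
`StrachanSwanepoel2026_nestedSolutions` (Theorem 2, nestedness); PROVED
`mem_triTwoDistanceGenerators_iff`, `card_triTwoDistanceGenerators`, `maxEdges_seven`,
`inducedDarts_eq_card_mul_sub_edgeBoundary` (`#darts + ∂ = |U|·|S|` — the regular-graph identity
behind "minimizing `∂` = maximizing edges").

WHAT IS NOT HERE: the proofs (Bollobás–Leader / Loomis–Whitney for Theorem 1; the 12-gon hulls,
computer-verified base cases and orderings of §3–§5 for Theorem 2); the uniqueness up to translation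
of the extremal sets at `n = 24k² − 24k + 7` (§3, p0006); Conjecture 3.
-/

noncomputable section

open Finset

namespace Literature.Combinatorics.Extremal.StrachanSwanepoel2026

open Literature.Geometry.DiscreteGeometry.HarborthSpiral (normForm)

/-! ## §1 The edge-isoperimetric problem of a Cayley graph (Definitions 1–2) -/

section Cayley

variable {G : Type*} [AddCommGroup G] [DecidableEq G]

/-- **The edge boundary `∂(S)`** of a finite vertex set `S` of the Cayley graph `G_U` (symmetric
generating set `U`): the number of pairs `(x, u) ∈ S × U` with `x + u ∉ S`, i.e. of edges `{x, x+u}`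
leaving `S`. [cite: StrachanSwanepoel2026, Definition 1 and Definition 2 (§1, p0003)] -/
def edgeBoundary (U S : Finset G) : ℕ :=
  ((S ×ˢ U).filter fun p => p.1 + p.2 ∉ S).card

/-- **Twice the number of edges of the induced subgraph `G_U[S]`**: the number of ordered pairs
`(x, y) ∈ S × S` with `y − x ∈ U`. [cite: StrachanSwanepoel2026, Definition 2 and the display `|E(G[S])| = (k|S| − ∂(S))/2` (§1, p0003)] -/
def inducedDarts (U S : Finset G) : ℕ :=
  ((S ×ˢ S).filter fun p => p.2 - p.1 ∈ U).card

/-- **`S` is a solution to the EIP of `G_U`**: its edge boundary is minimal among vertex sets of the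
same cardinality. [cite: StrachanSwanepoel2026, Definition 1 (§1, p0003)] -/
def IsEIPSolution (U S : Finset G) : Prop :=
  ∀ T : Finset G, T.card = S.card → edgeBoundary U S ≤ edgeBoundary U T

/-- **The EIP of `G_U` has nested solutions**: there is an ordering `v₁, v₂, …` of the (countably
infinite) vertex set — an enumeration without repetitions — such that every initial segment
`{v₁, …, v_n}` is a solution. [cite: StrachanSwanepoel2026, Definition 1 (§1, p0003)] -/
def HasNestedSolutions (U : Finset G) : Prop :=
  ∃ v : ℕ → G, Function.Bijective v ∧ ∀ n : ℕ, IsEIPSolution U ((Finset.range n).image v)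

/-- **`#darts(S) + ∂(S) = |U|·|S|`**: every pair `(x, u) ∈ S × U` either stays in `S` (an ordered
adjacent pair `(x, x+u)`) or leaves it — the identity `|E(G[S])| = (k|S| − ∂(S))/2` for the
`k = |U|`-regular Cayley graph, so that minimizing `∂` is maximizing the number of edges.
[cite: StrachanSwanepoel2026, §1 (p0003), display `|E(G[S])| = (k|S| − ∂(S))/2`] -/
theorem inducedDarts_add_edgeBoundary (U S : Finset G) :
    inducedDarts U S + edgeBoundary U S = U.card * S.card := by
  classical
  unfold inducedDarts edgeBoundary
  -- darts ↔ pairs `(x, u)` with `x + u ∈ S`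
  have h1 : ((S ×ˢ S).filter fun p : G × G => p.2 - p.1 ∈ U).card =
      ((S ×ˢ U).filter fun p : G × G => p.1 + p.2 ∈ S).card := by
    refine Finset.card_bij (fun p _ => (p.1, p.2 - p.1)) ?_ ?_ ?_
    · intro p hp
      simp only [Finset.mem_filter, Finset.mem_product] at hp ⊢
      exact ⟨⟨hp.1.1, hp.2⟩, by rw [add_sub_cancel]; exact hp.1.2⟩
    · intro p hp q hq h
      simp only [Prod.mk.injEq] at h
      obtain ⟨h1, h2⟩ := h
      have : p.2 = q.2 := by
        rw [← sub_add_cancel p.2 p.1, h2, h1, sub_add_cancel]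
      exact Prod.ext h1 this
    · intro q hq
      simp only [Finset.mem_filter, Finset.mem_product] at hq
      refine ⟨(q.1, q.1 + q.2), ?_, ?_⟩
      · simp only [Finset.mem_filter, Finset.mem_product]
        exact ⟨⟨hq.1.1, hq.2⟩, by rw [add_sub_cancel_left]; exact hq.1.2⟩
      · simp
  rw [h1, Finset.card_filter_add_card_filter_not, Finset.card_product, mul_comm]

end Cayley

/-! ## §2 Theorem 1: `ℤ^d` with generators `{±eᵢ} ∪ {±2e₁}` has no nested solutions, from any size -/

/-- The generating set `{±eᵢ : i = 1,…,d} ∪ {±2e_{i₀}}` of `ℤ^d` (`i₀` the doubled axis; in the source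
`i₀ = 1`, i.e. the index `0`). [cite: StrachanSwanepoel2026, Theorem 1 (§1, p0003)] -/
def doubledAxisGenerators (d : ℕ) (i₀ : Fin d) : Finset (Fin d → ℤ) :=
  (Finset.univ.image fun i : Fin d => Pi.single i (1 : ℤ)) ∪
    (Finset.univ.image fun i : Fin d => Pi.single i (-1 : ℤ)) ∪
      {Pi.single i₀ (2 : ℤ), Pi.single i₀ (-2 : ℤ)}

/-- **Strachan–Swanepoel 2026, Theorem 1, NAMED FACT.**  For every `d ≥ 2`, the EIP of the Cayley
graph `ℤ^d_U`, `U = {±eᵢ : i = 1,…,d} ∪ {±2e₁}`, has no nested solutions starting at any size: for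
every `n` and every solution `S_n` with `n` elements there is no chain `S_n ⊂ S_{n+1} ⊂ S_{n+2} ⊂ ⋯` of
solutions `Sᵢ` with `i` elements (`i ≥ n`).  (Answers the question of Barber–Erde negatively in all
dimensions `d ≥ 2`.) [cite: StrachanSwanepoel2026, Theorem 1 (§1, p0003); proof §2 (p0005)] -/
def StrachanSwanepoel2026_noNestedSolutions : Prop :=
  ∀ (d : ℕ) (hd : 2 ≤ d) (n : ℕ) (S : Finset (Fin d → ℤ)), S.card = n →
    IsEIPSolution (doubledAxisGenerators d ⟨0, by omega⟩) S →
      ¬ ∃ T : ℕ → Finset (Fin d → ℤ), T n = S ∧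
        ∀ i, n ≤ i → (T i).card = i ∧ IsEIPSolution (doubledAxisGenerators d ⟨0, by omega⟩) (T i) ∧
          T i ⊂ T (i + 1)

/-! ## §3 Theorem 2: the triangular lattice with first and second neighbours -/

/-- **The twelve generators of `Λ_U`** in labels: the lattice vectors `m g₁ + n g₂` of length `1`
(`±g₁, ±g₂, ±(g₂ − g₁)`) or `√3` (`±(g₁+g₂), ±(2g₂−g₁), ±(g₂−2g₁)`).
[cite: StrachanSwanepoel2026, Theorem 2 (§1, p0004)] -/
def triTwoDistanceGenerators : Finset (ℤ × ℤ) :=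
  {(1, 0), (-1, 0), (0, 1), (0, -1), (-1, 1), (1, -1),
    (1, 1), (-1, -1), (-1, 2), (1, -2), (-2, 1), (2, -1)}

/-- The twelve generators are exactly the labels of norm form `m² + mn + n² ∈ {1, 3}`, i.e. the
lattice vectors of length `1` or `√3` ("edges for all pairs at distance `1` or `√3`").
[cite: StrachanSwanepoel2026, §1 (p0004) ("the graph on the triangular lattice with edges for all pairs at distance `1` or `√3`")] -/
theorem mem_triTwoDistanceGenerators_iff (q : ℤ × ℤ) :
    q ∈ triTwoDistanceGenerators ↔ normForm q = 1 ∨ normForm q = 3 := by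
  obtain ⟨m, n⟩ := q
  constructor
  · intro h
    simp only [triTwoDistanceGenerators, Finset.mem_insert, Finset.mem_singleton, Prod.mk.injEq] at h
    rcases h with ⟨rfl, rfl⟩ | ⟨rfl, rfl⟩ | ⟨rfl, rfl⟩ | ⟨rfl, rfl⟩ | ⟨rfl, rfl⟩ | ⟨rfl, rfl⟩ |
      ⟨rfl, rfl⟩ | ⟨rfl, rfl⟩ | ⟨rfl, rfl⟩ | ⟨rfl, rfl⟩ | ⟨rfl, rfl⟩ | ⟨rfl, rfl⟩ <;>
      simp [normForm]
  · intro h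
    simp only [normForm] at h
    have h3 : 3 * n ^ 2 ≤ 12 := by rcases h with h | h <;> nlinarith [sq_nonneg (2 * m + n)]
    have h3' : 3 * m ^ 2 ≤ 12 := by rcases h with h | h <;> nlinarith [sq_nonneg (2 * n + m)]
    have hn : n ^ 2 ≤ 4 := by omega
    have hm : m ^ 2 ≤ 4 := by omega
    have hn2 : -2 ≤ n ∧ n ≤ 2 := by constructor <;> nlinarith
    have hm2 : -2 ≤ m ∧ m ≤ 2 := by constructor <;> nlinarith
    obtain ⟨hn1, hn2⟩ := hn2
    obtain ⟨hm1, hm2⟩ := hm2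
    simp only [triTwoDistanceGenerators, Finset.mem_insert, Finset.mem_singleton, Prod.mk.injEq]
    interval_cases m <;> interval_cases n <;> omega

/-- `Λ_U` is `12`-regular. [cite: StrachanSwanepoel2026, §3 (p0006) ("`Λ_U` is a `12`-regular graph")] -/
theorem card_triTwoDistanceGenerators : triTwoDistanceGenerators.card = 12 := by
  decide

open Classical in
/-- **`e(n)`**: `6n − 4√(6n − 6)` if `n = 24k² − 24k + 7` for some `k` (then `6n − 6 = (12k − 6)²`, so the
value is the integer `6n − 48k + 24`), and `⌊6n − √(96n − 63)⌋` otherwise.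
[cite: StrachanSwanepoel2026, Theorem 2 (§1, p0004)] -/
def maxEdges (n : ℕ) : ℤ :=
  if ∃ k : ℕ, n = 24 * k ^ 2 - 24 * k + 7 then ⌊(6 * n : ℝ) - 4 * Real.sqrt (6 * n - 6)⌋
  else ⌊(6 * n : ℝ) - Real.sqrt (96 * n - 63)⌋

/-- `e(7) = 6·7 − 4√36 = 18`: the hexagon `H₁` (a disc and its six neighbours) has `12` unit bonds and
`6` bonds of length `√3` — the first exceptional value `n = 7 = 24·1² − 24·1 + 7`.
[cite: StrachanSwanepoel2026, Theorem 2 and the list `n = 7, 55, 151, …` (§1, p0004)] -/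
theorem maxEdges_seven : maxEdges 7 = 18 := by
  have h : ∃ k : ℕ, (7 : ℕ) = 24 * k ^ 2 - 24 * k + 7 := ⟨1, by norm_num⟩
  rw [maxEdges, if_pos h]
  have h36 : Real.sqrt (6 * ((7 : ℕ) : ℝ) - 6) = 6 := by
    rw [show (6 * ((7 : ℕ) : ℝ) - 6) = 6 ^ 2 by norm_num, Real.sqrt_sq (by norm_num)]
  rw [h36]
  norm_num

/-- **Strachan–Swanepoel 2026, Theorem 2 (the value of the EIP of `Λ_U`), NAMED FACT.**  For every
`n ≥ 3`, the maximum number of edges of an (induced) subgraph of `Λ_U` — the triangular lattice with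
edges between points at distance `1` or `√3` — on `n` vertices is `e(n)` (`maxEdges n`): every
`n`-point label set has at most `2e(n)` ordered adjacent pairs, and some `n`-point set has exactly
`2e(n)`. [cite: StrachanSwanepoel2026, Theorem 2 (§1, p0004); proof §3–§5] -/
def StrachanSwanepoel2026_maxEdges : Prop :=
  ∀ n : ℕ, 3 ≤ n →
    (∀ S : Finset (ℤ × ℤ), S.card = n →
        (inducedDarts triTwoDistanceGenerators S : ℤ) ≤ 2 * maxEdges n) ∧
      ∃ S : Finset (ℤ × ℤ), S.card = n ∧
        (inducedDarts triTwoDistanceGenerators S : ℤ) = 2 * maxEdges n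

/-- **Strachan–Swanepoel 2026, Theorem 2 (nested solutions), NAMED FACT.**  "Additionally, the EIP of
`Λ_U` has nested solutions": there is an ordering of the triangular lattice all of whose initial
segments minimize the edge boundary (equivalently, by `12`-regularity, maximize the number of edges)
among sets of their size. [cite: StrachanSwanepoel2026, Theorem 2 (§1, p0004); §5] -/
def StrachanSwanepoel2026_nestedSolutions : Prop :=
  HasNestedSolutions triTwoDistanceGenerators

end Literature.Combinatorics.Extremal.StrachanSwanepoel2026

end
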